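import Literature.Computation.KummerOrbifold.ClosureCertificate5
import HarnessLib

/-!
# Kummer orbifold model, `m = 5`: closure certificate, image checks Ib (COMPUTATIONAL, `native_decide`)

Sequel of `ClosureCertificate5` (cell `hodge-kum4`, seat p1; consumer spec 2ea65998af615100): part Ib of
**(C3b)** — for every Reynolds basis vector `b` of the invariant sub-space `R` and every operator
`T = op5 j`, `j = 6, …, 11` (`G_5`, the twisted generator `δ = G_6`, the untwisted degree-3 generators
`G_7, …, G_10`), the image `T b` is centralizer-invariant.  Part I (`ClosureCertificate5ImagesI`) does
`j = 0, …, 5` and part II (`ClosureCertificate5ImagesII`) does `j = 12, …, 16`; the three parts are separate files only because of the gate's 600 s elaboration cap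
(the checks are independent conjuncts).  Together with `ClosureCertificate5`: `T(R) ⊆ R` for all 17 operators, hence
`C₀ ⊆ R`, `dim C₀ ≤ 1566`, and with `rankWords5`: `C₀ = R`, `dim C₀ = 1566`.  EVIDENCE for the computed
clause of MODEL_X; not used by the kernel assembly.
-/

set_option autoImplicit false

namespace Literature.Computation.KummerOrbifold

/-- **(C3b, images Ib)** For every Reynolds basis vector `b` and every operator `T = op5 j`,
`6 ≤ j ≤ 11` (`G_5`, `δ = G_6`, the untwisted degree-3 generators `G_7, …, G_10`), `T b` is
centralizer-invariant. [cite: FantechiGoettsche2003, §3 (Thm. 3.10, the ring structure; genus/obstruction rule)] -/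
theorem images5_invariant_Ib :
    reynoldsBasis5Sp.all (imagesInvariantOps [6, 7, 8, 9, 10, 11]) = true := by
  native_decide

end Literature.Computation.KummerOrbifold
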